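import Summits.ValiantsHypothesis.ValiantsHypothesis.Theorems.SymPencilPerFourColSix
import Summits.ValiantsHypothesis.ValiantsHypothesis.Theorems.SymPencilPerFourColSixLever
import Summits.ValiantsHypothesis.ValiantsHypothesis.Theorems.SymPencilPerFourColSixLeverTwentySeven
import Summits.ValiantsHypothesis.ValiantsHypothesis.Theorems.SymPencilPerFourColSixPair

/-!
# Route `SymPencil` — row `r = 10` of the size-`28` table: the threshold-shifted declarations of
# `SymPencilPerFourColSix` (`--supports` stmt-ValiantsHypothesis-5674 `SdcSuperquadratic`; rung currency only)

The declarations below (suffix `_m28`) are those of the landed `…Theorems.SymPencilPerFourColSix` whose meaning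
changes when its numerical thresholds move by one unit — `Fin 6 → Fin 7` square families /
`|ι'| ≤ 26 → ≤ 27` / `m ≤ 27 → m ≤ 28`, as applicable — with proofs VERBATIM; unchanged
declarations are used from the original module by name (same namespace).  Why it elaborates
(m = 28 table audit, val-lit-p6 g17, 2026-08-29; reader of record val-idea-crit-5 g4, probe P31):
the leaves of the `(10, 6)` chain are stated for `card ι < 8` / `< 9`, and every size lever reads
`4·rk bL ≤ 2·dim K + |ι'|` through integer division — one unit of slack throughout.  The `_m28`
statements imply the landed ones.

Honest framing: part of ONE row (cell `(10, 6, 7)`) of the size-`28` table; nothing about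
`sdc(per_4)` follows here; `28 ≤ sdc(per_4) ≤ 29` of record, the crux `SdcSuperquadratic` and
`VP ≠ VNP` untouched.  Credit: mathematics and proof text of `SymPencilPerFourColSix` (its authors); this file only
moves the bound.  No definitions, no named facts. [folklore]
-/

noncomputable section

-- single-conjunct layout: Sub = Summit, duplicated namespace component intended
set_option linter.dupNamespace false

namespace Summit.ValiantsHypothesis.ValiantsHypothesis.Theorems.SymPencilPerFourColSix

open Matrix MvPolynomial Module
open Literature.Computability.AlgebraicComplexity
open Summit.ValiantsHypothesis.ValiantsHypothesis.Theorems.SymPencilPerFourColSixLever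
open Summit.ValiantsHypothesis.ValiantsHypothesis.Theorems.SymPencilPerFourColSixPair

universe u

variable {k : Type u} [Field k] [CharZero k] {ι' : Type*} [Fintype ι'] [DecidableEq ι']

/-- **`W_col` is not a kernel space at size `27`.**  See the module docstring. [folklore] -/
theorem false_of_ker_eq_colW_m28 {D : Matrix ι' ι' k} (hD : IsUnit D.det) (hDs : Dᵀ = D)
    (bL : (Fin 4 × Fin 4 → k) →ₗ[k] (ι' → k)) (CL : (Fin 4 × Fin 4 → k) →ₗ[k] Matrix ι' ι' k)
    (hCs : ∀ z, (CL z)ᵀ = CL z) {κ : k} (hκ : κ ≠ 0)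
    (hi : ∀ z, bL z ⬝ᵥ D⁻¹ *ᵥ bL z = 0)
    (hii : ∀ z, bL z ⬝ᵥ (D⁻¹ * CL z * D⁻¹) *ᵥ bL z = 0)
    (hN : ∀ v, bL v = 0 → IsUnit (D + CL v).det ∧ ∀ (z : Fin 4 × Fin 4 → k) (s : k),
      κ * MvPolynomial.eval (v + s • z) (perPoly (Fin 4) k) =
        (Matrix.fromBlocks ((s * 0) • (1 : Matrix Unit Unit k))
          (Matrix.replicateRow Unit (s • bL z)) (Matrix.replicateCol Unit (s • bL z))
          (D + CL v + s • CL z)).det)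
    (hker : ∀ x : Fin 4 × Fin 4 → k,
      bL x = 0 ↔ ∀ z : Fin 4 × Fin 4, ¬ ((z.1 = 0 ∨ z.1 = 1) ∧ z.2 ≠ 0) → x z = 0)
    (h10 : 10 ≤ finrank k (LinearMap.range bL)) (hcard : Fintype.card ι' ≤ 27) : False := by
  classical
  -- the embedding `bE = bL ∘ embZ` of `Z8 = k² × k^{2×3}` and `B8 = bE(Z8)`
  let embZ : ((Fin 2 → k) × (Fin 2 × Fin 3 → k)) →ₗ[k] (Fin 4 × Fin 4 → k) :=
    { toFun := fun x z => (Matrix.of ![![x.1 0, 0, 0, 0], ![x.1 1, 0, 0, 0],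
        ![0, x.2 (0, 0), x.2 (0, 1), x.2 (0, 2)], ![0, x.2 (1, 0), x.2 (1, 1), x.2 (1, 2)]]) z.1 z.2
      map_add' := fun x y => by
        funext z; obtain ⟨i, j⟩ := z
        fin_cases i <;> fin_cases j <;> simp
      map_smul' := fun c x => by
        funext z; obtain ⟨i, j⟩ := z
        fin_cases i <;> fin_cases j <;> simp }
  have hembZ : ∀ x, embZ x = fun z : Fin 4 × Fin 4 => (Matrix.of ![![x.1 0, 0, 0, 0],
      ![x.1 1, 0, 0, 0], ![0, x.2 (0, 0), x.2 (0, 1), x.2 (0, 2)],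
      ![0, x.2 (1, 0), x.2 (1, 1), x.2 (1, 2)]]) z.1 z.2 := fun _ => rfl
  set bE := bL ∘ₗ embZ with hbE
  have hbE' : ∀ (c : Fin 2 → k) (r : Fin 2 × Fin 3 → k), bL (fun z : Fin 4 × Fin 4 =>
        (Matrix.of ![![c 0, 0, 0, 0], ![c 1, 0, 0, 0], ![0, r (0, 0), r (0, 1), r (0, 2)],
          ![0, r (1, 0), r (1, 1), r (1, 2)]]) z.1 z.2) = bE (c, r) :=
    fun _ _ => rfl
  have hinj : Function.Injective bE := by
    rw [← LinearMap.ker_eq_bot, Submodule.eq_bot_iff]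
    intro x hx
    rw [LinearMap.mem_ker, hbE, LinearMap.comp_apply, hembZ] at hx
    have h := (hker _).1 hx
    have e00 : x.1 0 = 0 := by simpa using h (0, 0) (by simp)
    have e10 : x.1 1 = 0 := by simpa using h (1, 0) (by simp)
    have e21 : x.2 (0, 0) = 0 := by simpa using h (2, 1) (by simp)
    have e22 : x.2 (0, 1) = 0 := by simpa using h (2, 2) (by simp)
    have e23 : x.2 (0, 2) = 0 := by simpa using h (2, 3) (by simp)
    have e31 : x.2 (1, 0) = 0 := by simpa using h (3, 1) (by simp)
    have e32 : x.2 (1, 1) = 0 := by simpa using h (3, 2) (by simp)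
    have e33 : x.2 (1, 2) = 0 := by simpa using h (3, 3) (by simp)
    clear_value embZ bE
    refine Prod.ext (funext fun i => ?_) (funext fun p => ?_)
    · fin_cases i <;> simp [e00, e10]
    · obtain ⟨i, j⟩ := p
      rw [Prod.snd_zero, Pi.zero_apply]
      fin_cases i <;> fin_cases j <;> simp [e21, e22, e23, e31, e32, e33]
  have hbEx : ∀ x, bE x = bL (embZ x) := fun _ => rfl
  clear_value embZ bE
  set B := LinearMap.range bL with hBdef
  set B8 := LinearMap.range bE with hB8
  have hB8B : B8 ≤ B := by rw [hB8, hbE]; exact LinearMap.range_comp_le_range _ _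
  have hB8dim : finrank k B8 = 8 := by
    rw [hB8, LinearMap.finrank_range_of_inj hinj, Module.finrank_prod]; simp
  -- the three directions and their lever data
  have hda := colW_lever_m28 hD hDs bL CL hCs hκ hii hN hker h10 hcard _ (Or.inl rfl)
  have hdb₁ := colW_lever_m28 hD hDs bL CL hCs hκ hii hN hker h10 hcard _ (Or.inr (Or.inl rfl))
  have hdb₂ := colW_lever_m28 hD hDs bL CL hCs hκ hii hN hker h10 hcard _ (Or.inr (Or.inr rfl))
  set Na := (CL (fun z : Fin 4 × Fin 4 =>
      (Matrix.of ![![0, 1, 1, 1], ![0, 0, 0, 0], ![0, 0, 0, 0], ![0, 0, 0, 0]]) z.1 z.2) * D⁻¹).mulVecLin with hNa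
  set Nb₁ := (CL (fun z : Fin 4 × Fin 4 =>
      (Matrix.of ![![0, 0, 0, 0], ![0, 1, 1, 1], ![0, 0, 0, 0], ![0, 0, 0, 0]]) z.1 z.2) * D⁻¹).mulVecLin with hNb₁
  set Nb₂ := (CL (fun z : Fin 4 × Fin 4 =>
      (Matrix.of ![![0, 0, 0, 0], ![0, 1, 1, 2], ![0, 0, 0, 0], ![0, 0, 0, 0]]) z.1 z.2) * D⁻¹).mulVecLin with hNb₂
  set Ka := (B ⊓ B.comap Na : Submodule k (ι' → k)) with hKa
  set Kb₁ := (B ⊓ B.comap Nb₁ : Submodule k (ι' → k)) with hKb₁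
  set Kb₂ := (B ⊓ B.comap Nb₂ : Submodule k (ι' → k)) with hKb₂
  have hNa_app : ∀ y, Na y = CL (fun z : Fin 4 × Fin 4 =>
      (Matrix.of ![![0, 1, 1, 1], ![0, 0, 0, 0], ![0, 0, 0, 0], ![0, 0, 0, 0]]) z.1 z.2) *ᵥ (D⁻¹ *ᵥ y) := fun y => by
    rw [hNa, Matrix.mulVecLin_apply, Matrix.mulVec_mulVec]
  have hNb₁_app : ∀ y, Nb₁ y = CL (fun z : Fin 4 × Fin 4 =>
      (Matrix.of ![![0, 0, 0, 0], ![0, 1, 1, 1], ![0, 0, 0, 0], ![0, 0, 0, 0]]) z.1 z.2) *ᵥ (D⁻¹ *ᵥ y) := fun y => by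
    rw [hNb₁, Matrix.mulVecLin_apply, Matrix.mulVec_mulVec]
  have hNb₂_app : ∀ y, Nb₂ y = CL (fun z : Fin 4 × Fin 4 =>
      (Matrix.of ![![0, 0, 0, 0], ![0, 1, 1, 2], ![0, 0, 0, 0], ![0, 0, 0, 0]]) z.1 z.2) *ᵥ (D⁻¹ *ᵥ y) := fun y => by
    rw [hNb₂, Matrix.mulVecLin_apply, Matrix.mulVec_mulVec]
  -- `K ≤ B8`, `N K ≤ B8`
  have hKle : ∀ {N' : (ι' → k) →ₗ[k] (ι' → k)} {K' : Submodule k (ι' → k)},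
      (∀ y ∈ K', (∃ (c : Fin 2 → k) (r : Fin 2 × Fin 3 → k), y = bL (fun z : Fin 4 × Fin 4 =>
        (Matrix.of ![![c 0, 0, 0, 0], ![c 1, 0, 0, 0], ![0, r (0, 0), r (0, 1), r (0, 2)],
          ![0, r (1, 0), r (1, 1), r (1, 2)]]) z.1 z.2)) ∧
        (∃ (c : Fin 2 → k) (r : Fin 2 × Fin 3 → k), N' y = bL (fun z : Fin 4 × Fin 4 =>
        (Matrix.of ![![c 0, 0, 0, 0], ![c 1, 0, 0, 0], ![0, r (0, 0), r (0, 1), r (0, 2)],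
          ![0, r (1, 0), r (1, 1), r (1, 2)]]) z.1 z.2))) →
      K' ≤ B8 ∧ ∀ y ∈ K', N' y ∈ B8 := by
    intro N' K' h
    refine ⟨fun y hy => ?_, fun y hy => ?_⟩
    · obtain ⟨c, r, e⟩ := (h y hy).1
      exact ⟨(c, r), by rw [e, hbE']⟩
    · obtain ⟨c, r, e⟩ := (h y hy).2
      exact ⟨(c, r), by rw [e, hbE']⟩
  obtain ⟨hKa8, hNaKa⟩ := hKle (N' := Na) (K' := Ka)
    (fun y hy => by simpa only [hNa_app] using hda.2 y hy)
  obtain ⟨hKb₁8, hNbKb₁⟩ := hKle (N' := Nb₁) (K' := Kb₁)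
    (fun y hy => by simpa only [hNb₁_app] using hdb₁.2 y hy)
  obtain ⟨hKb₂8, hNbKb₂⟩ := hKle (N' := Nb₂) (K' := Kb₂)
    (fun y hy => by simpa only [hNb₂_app] using hdb₂.2 y hy)
  have h7a : 7 ≤ finrank k Ka := hda.1
  have h7b₁ : 7 ≤ finrank k Kb₁ := hdb₁.1
  have h7b₂ : 7 ≤ finrank k Kb₂ := hdb₂.1
  -- the two-row base points `v = t' a + t b(β₃)` lie in the kernel
  have hker_v : ∀ (β₃ t t' : k), bL (fun w : Fin 4 × Fin 4 =>
        (Matrix.of ![![0, t', t', t'], ![0, t * 1, t * 1, t * β₃], ![0, 0, 0, 0], ![0, 0, 0, 0]])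
          w.1 w.2) = 0 :=
    fun β₃ t t' => (hker _).2 (tworow_support β₃ t t')
  -- GEN: `S' ⊆ B8` with `N_a S' + N_b S' ⊆ B8` has `dim ≤ 6`, and the two coordinate forms of
  -- `b` vanish on `bE⁻¹((1 + t'N_a + tN_b) S')`
  have gen : ∀ (β₃ t t' : k), t ≠ 0 → t' ≠ 0 → (1 + β₃ : k) ≠ 0 →
      ∀ (Nb : (ι' → k) →ₗ[k] (ι' → k)), (∀ y, Nb y = CL (fun z : Fin 4 × Fin 4 =>
        (Matrix.of ![![0, 0, 0, 0], ![0, 1, 1, β₃], ![0, 0, 0, 0], ![0, 0, 0, 0]]) z.1 z.2) *ᵥ (D⁻¹ *ᵥ y)) →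
      ∀ S' : Submodule k (ι' → k), S' ≤ B8 → (∀ y ∈ S', Na y ∈ B8) →
      (∀ y ∈ S', Nb y ∈ B8) →
      finrank k S' ≤ 6 ∧ ∀ y ∈ S', ∀ x, bE x = y + t' • Na y + t • Nb y →
        (1 + β₃) * x.2 (1, 0) + (1 + β₃) * x.2 (1, 1) + (1 + 1) * x.2 (1, 2) = 0 ∧
        (1 + β₃) * x.2 (0, 0) + (1 + β₃) * x.2 (0, 1) + (1 + 1) * x.2 (0, 2) = 0 := by
    intro β₃ t t' ht ht' hb Nb hNb S' hS'8 hNaS' hNbS'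
    have hvu : IsUnit (D + CL (fun w : Fin 4 × Fin 4 =>
        (Matrix.of ![![0, t', t', t'], ![0, t * 1, t * 1, t * β₃], ![0, 0, 0, 0], ![0, 0, 0, 0]])
          w.1 w.2)).det := (hN _ (hker_v β₃ t t')).1
    have hT : ∀ y, ((D + CL (fun w : Fin 4 × Fin 4 =>
        (Matrix.of ![![0, t', t', t'], ![0, t * 1, t * 1, t * β₃], ![0, 0, 0, 0], ![0, 0, 0, 0]])
          w.1 w.2)) * D⁻¹) *ᵥ y = y + t' • Na y + t • Nb y := by
      intro y
      rw [tworow_eq, map_add, map_smul, map_smul, Matrix.add_mul, Matrix.mul_nonsing_inv _ hD,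
        Matrix.add_mul, Matrix.smul_mul, Matrix.smul_mul, Matrix.add_mulVec,
        Matrix.add_mulVec, Matrix.one_mulVec, Matrix.smul_mulVec,
        Matrix.smul_mulVec, ← Matrix.mulVec_mulVec, ← Matrix.mulVec_mulVec, ← hNa_app,
        ← hNb, add_assoc]
    have hforms : ∀ y ∈ S', ∀ x, bE x = y + t' • Na y + t • Nb y →
        (1 + β₃) * x.2 (1, 0) + (1 + β₃) * x.2 (1, 1) + (1 + 1) * x.2 (1, 2) = 0 ∧
        (1 + β₃) * x.2 (0, 0) + (1 + β₃) * x.2 (0, 1) + (1 + 1) * x.2 (0, 2) = 0 := by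
      intro y hy x hx
      obtain ⟨z'', hz''⟩ := hB8B (hS'8 hy)
      have hy' : bL (embZ x) = ((D + CL (fun w : Fin 4 × Fin 4 =>
        (Matrix.of ![![0, t', t', t'], ![0, t * 1, t * 1, t * β₃], ![0, 0, 0, 0], ![0, 0, 0, 0]])
          w.1 w.2)) * D⁻¹) *ᵥ bL z'' := by
        rw [hT, hz'', ← hx, hbEx]
      have hp := pair_vanish hDs bL CL hCs hκ hi hN 1 1 β₃ t t' (hker_v β₃ t t') (embZ x) z''
        (by simp [hembZ]) (by simp [hembZ]) hy'
      simp only [hembZ, Matrix.of_apply, Matrix.cons_val] at hp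
      have htt : t * t' ≠ 0 := mul_ne_zero ht ht'
      exact ⟨(mul_eq_zero.1 hp.1).resolve_left htt, (mul_eq_zero.1 hp.2).resolve_left htt⟩
    refine ⟨?_, hforms⟩
    -- the translate `S = T S'` and the count
    obtain ⟨Z, hZ6, hZ⟩ := exists_ker_forms (k := k) (1 + β₃) (1 + β₃) (1 + 1) hb
    set T : (ι' → k) →ₗ[k] (ι' → k) := ((D + CL (fun w : Fin 4 × Fin 4 =>
        (Matrix.of ![![0, t', t', t'], ![0, t * 1, t * 1, t * β₃], ![0, 0, 0, 0], ![0, 0, 0, 0]])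
          w.1 w.2)) * D⁻¹).mulVecLin with hTdef
    have hTinj : Function.Injective T := by
      rw [hTdef, Matrix.coe_mulVecLin, Matrix.mulVec_injective_iff_isUnit,
        Matrix.isUnit_iff_isUnit_det, Matrix.det_mul]
      exact hvu.mul (Matrix.isUnit_nonsing_inv_det_iff.2 hD)
    have hS8 : S'.map T ≤ B8 := by
      rintro _ ⟨y, hy, rfl⟩
      rw [hTdef, Matrix.mulVecLin_apply, hT]
      exact B8.add_mem (B8.add_mem (hS'8 hy) (B8.smul_mem _ (hNaS' y hy)))
        (B8.smul_mem _ (hNbS' y hy))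
    have hcomap : (S'.map T).comap bE ≤ Z := by
      intro x hx
      rw [Submodule.mem_comap] at hx
      obtain ⟨y, hy, hyx⟩ := hx
      rw [hTdef, Matrix.mulVecLin_apply, hT] at hyx
      exact (hZ x).2 (hforms y hy x hyx.symm)
    have hmap : ((S'.map T).comap bE).map bE = S'.map T :=
      Submodule.map_comap_eq_self (by rwa [hB8] at hS8)
    calc finrank k S' = finrank k (S'.map T) :=
          (Submodule.equivMapOfInjective T hTinj S').finrank_eq
      _ = finrank k (((S'.map T).comap bE).map bE) := by rw [hmap]
      _ ≤ finrank k ((S'.map T).comap bE) := Submodule.finrank_map_le bE _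
      _ ≤ finrank k Z := Submodule.finrank_mono hcomap
      _ = 6 := hZ6
  -- STEP (7,7): `K_a ⊓ K_b = bE(Z(b))`, hence `bE(Z(b)) ≤ K_a`
  have hE_le : ∀ (β₃ : k), (1 + β₃ : k) ≠ 0 →
      ∀ Z : Submodule k ((Fin 2 → k) × (Fin 2 × Fin 3 → k)), finrank k Z = 6 →
      (∀ x, x ∈ Z ↔ ((1 + β₃) * x.2 (1, 0) + (1 + β₃) * x.2 (1, 1) + (1 + 1) * x.2 (1, 2) = 0 ∧
        (1 + β₃) * x.2 (0, 0) + (1 + β₃) * x.2 (0, 1) + (1 + 1) * x.2 (0, 2) = 0)) →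
      ∀ (Nb : (ι' → k) →ₗ[k] (ι' → k)), (∀ y, Nb y = CL (fun z : Fin 4 × Fin 4 =>
        (Matrix.of ![![0, 0, 0, 0], ![0, 1, 1, β₃], ![0, 0, 0, 0], ![0, 0, 0, 0]]) z.1 z.2) *ᵥ (D⁻¹ *ᵥ y)) →
      ∀ Kb : Submodule k (ι' → k), Kb ≤ B8 → (∀ y ∈ Kb, Nb y ∈ B8) → 7 ≤ finrank k Kb →
      Z.map bE ≤ Ka := by
    intro β₃ hb Z hZ6 hZ Nb hNb Kb hKb8 hNbKb h7b
    set S' := (Ka ⊓ Kb : Submodule k (ι' → k)) with hS'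
    have hS'8 : S' ≤ B8 := inf_le_left.trans hKa8
    have hNaS' : ∀ y ∈ S', Na y ∈ B8 := fun y hy => hNaKa y hy.1
    have hNbS' : ∀ y ∈ S', Nb y ∈ B8 := fun y hy => hNbKb y hy.2
    have g := fun (t t' : k) (ht : t ≠ 0) (ht' : t' ≠ 0) =>
      gen β₃ t t' ht ht' hb Nb hNb S' hS'8 hNaS' hNbS'
    have hmemB8 : ∀ y ∈ S', ∀ (t t' : k), t ≠ 0 → t' ≠ 0 →
        ∃ x, x ∈ Z ∧ bE x = y + t' • Na y + t • Nb y := by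
      intro y hy t t' ht ht'
      obtain ⟨x, hx⟩ : y + t' • Na y + t • Nb y ∈ B8 :=
        B8.add_mem (B8.add_mem (hS'8 hy) (B8.smul_mem _ (hNaS' y hy)))
          (B8.smul_mem _ (hNbS' y hy))
      exact ⟨x, (hZ x).2 ((g t t' ht ht').2 y hy x hx), hx⟩
    have hle : S' ≤ Z.map bE := by
      intro y hy
      obtain ⟨x₁₁, h₁₁, e₁₁⟩ := hmemB8 y hy 1 1 one_ne_zero one_ne_zero
      obtain ⟨x₂₁, h₂₁, e₂₁⟩ := hmemB8 y hy 1 2 one_ne_zero two_ne_zero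
      obtain ⟨x₁₂, h₁₂, e₁₂⟩ := hmemB8 y hy 2 1 two_ne_zero one_ne_zero
      refine ⟨(3 : k) • x₁₁ - x₂₁ - x₁₂, Z.sub_mem (Z.sub_mem (Z.smul_mem _ h₁₁) h₂₁) h₁₂, ?_⟩
      rw [map_sub, map_sub, map_smul, e₁₁, e₂₁, e₁₂]
      module
    have hsup : finrank k (Ka ⊔ Kb : Submodule k (ι' → k)) ≤ 8 :=
      hB8dim ▸ Submodule.finrank_mono (sup_le hKa8 hKb8)
    have hdim := Submodule.finrank_sup_add_finrank_inf_eq Ka Kb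
    have hZle : finrank k (Z.map bE) ≤ 6 := (Submodule.finrank_map_le _ _).trans hZ6.le
    have heq : S' = Z.map bE := Submodule.eq_of_le_of_finrank_le hle (by rw [hS']; omega)
    exact heq ▸ inf_le_left
  -- `E(b₁) + E(b₂) = B8 ≤ K_a`, so `K_a = B8`; then `S' = K_{b₁}` has `7 ≤ dim ≤ 6`
  obtain ⟨Z₁, hZ₁6, hZ₁⟩ := exists_ker_forms (k := k) (1 + 1) (1 + 1) (1 + 1) (by norm_num)
  obtain ⟨Z₂, hZ₂6, hZ₂⟩ := exists_ker_forms (k := k) (1 + 2) (1 + 2) (1 + 1) (by norm_num)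
  have h1 := hE_le 1 (by norm_num) Z₁ hZ₁6 hZ₁ Nb₁ hNb₁_app Kb₁ hKb₁8 hNbKb₁ h7b₁
  have h2 := hE_le 2 (by norm_num) Z₂ hZ₂6 hZ₂ Nb₂ hNb₂_app Kb₂ hKb₂8 hNbKb₂ h7b₂
  have hB8Ka : B8 ≤ Ka := by
    rintro _ ⟨x, rfl⟩
    obtain ⟨x₁, x₂, hx, hx₁, hx₂⟩ := exists_split x
    rw [hx, map_add]
    exact Ka.add_mem (h1 ⟨x₁, (hZ₁ x₁).2 hx₁, rfl⟩) (h2 ⟨x₂, (hZ₂ x₂).2 hx₂, rfl⟩)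
  have hKaB8 : Ka = B8 := le_antisymm hKa8 hB8Ka
  have h6 := (gen 1 1 1 one_ne_zero one_ne_zero (by norm_num) Nb₁ hNb₁_app Kb₁ hKb₁8
    (fun y hy => hNaKa y (by rw [hKaB8]; exact hKb₁8 hy)) hNbKb₁).1
  omega
end Summit.ValiantsHypothesis.ValiantsHypothesis.Theorems.SymPencilPerFourColSix

end
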